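import Summits.RiemannHypothesis.RiemannHypothesis.Theorems.IntegerScrewScrewPolyFloorLocalCoercivity
import HarnessLib

/-!
# Route IntegerScrew — an RH-free polynomial floor (exponent `A = 1`) for the screw form on
# balanced short windows

Crux `IntegerScrew.ScrewPolyFloor` (stmt-RiemannHypothesis-15757) asks for `A` and `c > 0` with
`c·M^{-A}·∑_{2≤m≤M} x_m² ≤ ∑_{2≤m,m'≤M} G(log m, log m') x_m x_m'` for ALL real `x`, where
`G(t,u) = Ψ(t) + Ψ(u) - Ψ(t-u)` is Suzuki's kernel of the screw function `Ψ = zetaScrew` of `ζ`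
(`Literature.NumberTheory.LFunctions.zetaScrewKernel`). For all `x` this is equivalent to the
Riemann hypothesis (`IntegerScrew.screwPolyFloor_iff_riemannHypothesis`,
`Theorems/IntegerScrewScrewPolyFloorStructure.lean`). This file proves the inequality
UNCONDITIONALLY, with the exponent `A = 1` that the numerics show for the full matrices
(`λ_min(S_M)·M ≈ 0.25`, kit j024838) and the explicit constant `c = (1 - log 2)/4`, on the
infinite sub-family of BALANCED vectors supported in a SHORT TOP WINDOW:

* `screwWindowFloor`: for all `N, M` with `M ≤ (1 + 1/250)·N` and all real `x` with
  `∑_{N<m≤M} x_m = 0`,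
  `(1 - log 2)/4 · M⁻¹ · ∑_{N<m≤M} x_m² ≤ ∑_{N<m,m'≤M} G(log m, log m') x_m x_m'`;
* `screwPolyFloor_on_balanced_windows`: the same in the literal shape of the crux (sums over
  `Finset.Icc 2 M`, factor `M ^ (-1 : ℝ)`) for `x` supported in `(N, M]` and balanced.

Mechanism (idea card `Cruxes/ScrewPolyFloor/Ideas/rh-free-window-floor.md`, crux-strategist
gen 1): on balanced vectors the `Ψ(log m) + Ψ(log m')` part of `G` dies, so the window form is
`-∑ x_m x_m' Ψ(log m - log m')`, a configuration of log-diameter `< 1/250` recentred at `log M` —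
on the prime-free wall, for every `N`; logarithms of distinct integers `≤ M` are `1/M`-separated
(`inv_le_abs_log_sub_log`) and `M ≥ 251`, so `|sᵢ| + 1/(2M) < 1/140` and
`IntegerScrewLocalFloor.local_coercivity` (the margin kept in Suzuki2023 Thm 4.2 + the energy
lower bound, `IntegerScrewScrewPolyFloorLocalCoercivity.lean`) gives the floor with `δ = 1/M`.

Honest scope (see the idea card): a side theorem beside the crux, not a step towards the `∀ x`
statement — positive semidefiniteness is not additive over subspaces, the bottom eigenvector of
`S_M` is global (not window-local), and beyond window ratio `2` the primes enter. What it records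
is the first RH-free `∀ M` statement of the crux's shape with a polynomial margin, and that the
integers enter it only through the separation `log(m+1) - log m ≥ 1/M`.

## References

* M. Suzuki, *Aspects of the screw function corresponding to the Riemann zeta-function*,
  J. Lond. Math. Soc. (2) 108 (2023), 1448–1487; arXiv:2206.03682, Thm 4.2. [Suzuki2023]
-/

noncomputable section

open scoped Topology BigOperators
open MeasureTheory Set

-- the layout-mandated namespace repeats the summit name
set_option linter.dupNamespace false

namespace Summit.RiemannHypothesis.RiemannHypothesis.Theorems.IntegerScrewLocalFloor

open Literature.NumberTheory.LFunctions

/-! ### Windows of integers -/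

/-- Logarithms of distinct positive integers `≤ M` are `1/M`-separated:
`|log m - log m'| ≥ log((k+1)/k) ≥ 1/(k+1) ≥ 1/M` for `k = min(m, m') < M`. [folklore] -/
theorem inv_le_abs_log_sub_log {M m m' : ℕ} (hm : 1 ≤ m) (hmM : m ≤ M) (hm' : 1 ≤ m')
    (hm'M : m' ≤ M) (hne : m ≠ m') :
    (M : ℝ)⁻¹ ≤ |Real.log m - Real.log m'| := by
  wlog hlt : m < m' generalizing m m'
  · have h := this hm' hm'M hm hmM (Ne.symm hne)
      (lt_of_le_of_ne (not_lt.1 hlt) (Ne.symm hne))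
    rwa [abs_sub_comm] at h
  have hm0 : (0 : ℝ) < m := by exact_mod_cast hm
  have hm1 : (m : ℝ) + 1 ≤ m' := by exact_mod_cast hlt
  have hMm : (m : ℝ) + 1 ≤ M := by exact_mod_cast (lt_of_lt_of_le hlt hm'M)
  have hx : (0 : ℝ) < ((m : ℝ) + 1) / m := by positivity
  have h3 := Real.one_sub_inv_le_log_of_pos hx
  rw [inv_div, Real.log_div (by positivity) hm0.ne'] at h3
  have h4 : 1 - (m : ℝ) / (m + 1) = ((m : ℝ) + 1)⁻¹ := by
    field_simp
    ring
  have h5 : (M : ℝ)⁻¹ ≤ ((m : ℝ) + 1)⁻¹ := inv_anti₀ (by positivity) hMm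
  have h6 : Real.log ((m : ℝ) + 1) ≤ Real.log m' := Real.log_le_log (by positivity) hm1
  have h7 : Real.log m ≤ Real.log m' := Real.log_le_log hm0 (by linarith)
  rw [abs_sub_comm, abs_of_nonneg (by linarith)]
  linarith

/-- **RH-free polynomial floor (exponent `A = 1`) on balanced short windows.** For all
`N, M` with `M ≤ (1 + 1/250)·N` and every real vector `x` with `∑_{N < m ≤ M} x_m = 0`,
`(1 - log 2)/4 · M⁻¹ · ∑_{N<m≤M} x_m² ≤ ∑_{N<m,m'≤M} G(log m, log m') x_m x_m'`,
`G = zetaScrewKernel` — unconditionally. On balanced vectors the `Ψ(log m) + Ψ(log m')` part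
of `G` dies, the window is a configuration of log-diameter `< 1/250` of `1/M`-separated points,
and `local_coercivity` applies (the arithmetic of the integers enters only through the
separation `log(m+1) - log m ≥ 1/M`; no prime is seen on the wall `|v| < log 2`). [folklore] -/
theorem screwWindowFloor (N M : ℕ) (x : ℕ → ℝ) (hMN : (M : ℝ) ≤ (1 + 1 / 250) * N)
    (hx : ∑ m ∈ Finset.Ioc N M, x m = 0) :
    (1 - Real.log 2) / 4 * (M : ℝ)⁻¹ * ∑ m ∈ Finset.Ioc N M, x m ^ 2 ≤
      ∑ m ∈ Finset.Ioc N M, ∑ m' ∈ Finset.Ioc N M,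
        zetaScrewKernel (Real.log m) (Real.log m') * (x m * x m') := by
  rcases le_or_gt M N with hle | hNM
  · simp [Finset.Ioc_eq_empty (not_lt.2 hle)]
  -- sizes: `N ≥ 250`, `M ≥ 251`
  have hN1 : (N : ℝ) + 1 ≤ M := by exact_mod_cast hNM
  have hN : (250 : ℝ) ≤ N := by nlinarith
  have hM : (251 : ℝ) ≤ M := by linarith
  have hMpos : (0 : ℝ) < M := by linarith
  set W := Finset.Ioc N M with hW
  -- Step 1: on balanced vectors the kernel form is `-∑∑ x x' Ψ(log m - log m')`
  have hform : ∑ m ∈ W, ∑ m' ∈ W, zetaScrewKernel (Real.log m) (Real.log m') * (x m * x m')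
      = -∑ m ∈ W, ∑ m' ∈ W, x m * x m' * zetaScrew (Real.log m - Real.log m') := by
    have e : ∀ m m' : ℕ, zetaScrewKernel (Real.log m) (Real.log m') * (x m * x m')
        = (zetaScrew (Real.log m) * x m * x m' + x m * (zetaScrew (Real.log m') * x m'))
          - x m * x m' * zetaScrew (Real.log m - Real.log m') := by
      intro m m'; rw [zetaScrewKernel_def]; ring
    have h1 : ∑ m ∈ W, ∑ m' ∈ W, zetaScrew (Real.log m) * x m * x m' = 0 :=
      Finset.sum_eq_zero fun m _ => by rw [← Finset.mul_sum, hx, mul_zero]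
    have h2 : ∑ m ∈ W, ∑ m' ∈ W, x m * (zetaScrew (Real.log m') * x m') = 0 := by
      simp_rw [← Finset.mul_sum]
      rw [← Finset.sum_mul, hx, zero_mul]
    rw [Finset.sum_congr rfl fun m _ => Finset.sum_congr rfl fun m' _ => e m m']
    simp only [Finset.sum_sub_distrib, Finset.sum_add_distrib]
    rw [h1, h2]
    ring
  -- Step 2: reindex the window by `Fin n`
  set n : ℕ := W.card with hn
  set eqv : Fin n ≃ ↥W := W.equivFin.symm with heqv
  have hmem : ∀ i : Fin n, N < ((eqv i : ℕ)) ∧ ((eqv i : ℕ)) ≤ M := fun i =>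
    Finset.mem_Ioc.1 (eqv i).2
  have hsum1 : ∀ f : ℕ → ℝ, ∑ i, f (eqv i : ℕ) = ∑ m ∈ W, f m := fun f => by
    rw [Fintype.sum_equiv eqv (fun i => f (eqv i : ℕ)) (fun j : ↥W => f (j : ℕ)) (fun _ => rfl),
      Finset.sum_coe_sort]
  have hsum2 : ∀ F : ℕ → ℕ → ℝ,
      ∑ i, ∑ j, F (eqv i : ℕ) (eqv j : ℕ) = ∑ m ∈ W, ∑ m' ∈ W, F m m' := fun F => by
    rw [Fintype.sum_equiv eqv (fun i => ∑ j, F (eqv i : ℕ) (eqv j : ℕ))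
      (fun a : ↥W => ∑ j, F (a : ℕ) (eqv j : ℕ)) (fun _ => rfl),
      Finset.sum_coe_sort W (fun a : ℕ => ∑ j, F a (eqv j : ℕ))]
    exact Finset.sum_congr rfl fun m _ => hsum1 (F m)
  -- Step 3: the hypotheses of `local_coercivity` for `sᵢ = log mᵢ - log M`, `δ = 1/M`
  have hδ : (0 : ℝ) < (M : ℝ)⁻¹ := inv_pos.2 hMpos
  have hsep : ∀ i j : Fin n, i ≠ j →
      (M : ℝ)⁻¹ ≤ |(Real.log (eqv i : ℕ) - Real.log M) - (Real.log (eqv j : ℕ) - Real.log M)| := by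
    intro i j hij
    rw [show (Real.log (eqv i : ℕ) - Real.log M) - (Real.log (eqv j : ℕ) - Real.log M)
        = Real.log (eqv i : ℕ) - Real.log (eqv j : ℕ) by ring]
    refine inv_le_abs_log_sub_log (by have := (hmem i).1; omega) (hmem i).2
      (by have := (hmem j).1; omega) (hmem j).2 (fun h => hij (eqv.injective (Subtype.ext h)))
  have hs : ∀ i : Fin n, |Real.log (eqv i : ℕ) - Real.log M| + (M : ℝ)⁻¹ / 2 ≤ 1 / 140 := by
    intro i
    have hmi : (N : ℝ) + 1 ≤ (eqv i : ℕ) := by exact_mod_cast (hmem i).1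
    have hmiM : ((eqv i : ℕ) : ℝ) ≤ M := by exact_mod_cast (hmem i).2
    have hmipos : (0 : ℝ) < (eqv i : ℕ) := by linarith
    have hlog0 : Real.log (eqv i : ℕ) ≤ Real.log M := Real.log_le_log hmipos hmiM
    have hq : (M : ℝ) / (eqv i : ℕ) < 1 + 1 / 250 := by
      rw [div_lt_iff₀ hmipos]
      linarith
    have hlog1 : Real.log M - Real.log (eqv i : ℕ) ≤ (M : ℝ) / (eqv i : ℕ) - 1 := by
      rw [← Real.log_div hMpos.ne' hmipos.ne']
      exact Real.log_le_sub_one_of_pos (div_pos hMpos hmipos)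
    have hinv : (M : ℝ)⁻¹ ≤ 1 / 251 := by
      rw [inv_eq_one_div]
      exact one_div_le_one_div_of_le (by norm_num) hM
    rw [abs_of_nonpos (by linarith)]
    linarith
  have key := local_coercivity hδ (fun i => Real.log (eqv i : ℕ) - Real.log M)
    (fun i => x (eqv i : ℕ)) hsep hs (by rw [hsum1 (fun m => x m)]; exact hx)
  -- Step 4: translate back to the window
  have hdiff : ∀ i j : Fin n, (Real.log (eqv i : ℕ) - Real.log M) - (Real.log (eqv j : ℕ) - Real.log M)
      = Real.log (eqv i : ℕ) - Real.log (eqv j : ℕ) := fun i j => by ring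
  simp only [hdiff] at key
  rw [hsum1 (fun m => x m ^ 2),
    hsum2 (fun m m' => x m * x m' * zetaScrew (Real.log m - Real.log m'))] at key
  rw [hform]
  calc (1 - Real.log 2) / 4 * (M : ℝ)⁻¹ * ∑ m ∈ W, x m ^ 2
      = (1 - Real.log 2) * ((M : ℝ)⁻¹ / 4) * ∑ m ∈ W, x m ^ 2 := by ring
    _ ≤ _ := key

/-- **The crux inequality, RH-free, on the sub-family of balanced short-window vectors.**
For all `N, M` with `M ≤ (1 + 1/250)·N` and every real `x` supported in `(N, M]` with
`∑ x_m = 0`, the inequality of `IntegerScrew.ScrewPolyFloor` holds with exponent `A = 1` and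
`c = (1 - log 2)/4`:
`c · M^{-1} · ∑_{2≤m≤M} x_m² ≤ ∑_{2≤m,m'≤M} G(log m, log m') x_m x_m'` — unconditionally
(`screwWindowFloor`; for `x` supported in the window the sums over `[2, M]` are the sums over
the window). This is an RH-free instance of the crux for an infinite sub-family at every level
`M`, with the exponent `A = 1` seen numerically for the full matrices; it does not bear on the
`∀ x` statement, which is equivalent to RH (`IntegerScrew.screwPolyFloor_iff_riemannHypothesis`).
[folklore] -/
theorem screwPolyFloor_on_balanced_windows :
    ∀ (N M : ℕ) (x : ℕ → ℝ), (M : ℝ) ≤ (1 + 1 / 250) * N → (∀ m, m ≤ N ∨ M < m → x m = 0) →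
      ∑ m ∈ Finset.Icc 2 M, x m = 0 →
      (1 - Real.log 2) / 4 * (M : ℝ) ^ (-(1 : ℝ)) * ∑ m ∈ Finset.Icc 2 M, x m ^ 2 ≤
        ∑ m ∈ Finset.Icc 2 M, ∑ m' ∈ Finset.Icc 2 M,
          Literature.NumberTheory.LFunctions.zetaScrewKernel (Real.log m) (Real.log m')
            * (x m * x m') := by
  intro N M x hMN hsupp hx
  rcases Nat.eq_zero_or_pos N with hN0 | hNpos
  · subst hN0
    have hM0 : M = 0 := by
      have : (M : ℝ) ≤ 0 := by simpa using hMN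
      exact_mod_cast le_antisymm this (Nat.cast_nonneg M)
    subst hM0
    simp
  have hsub : Finset.Ioc N M ⊆ Finset.Icc 2 M := by
    intro m hm
    simp only [Finset.mem_Ioc, Finset.mem_Icc] at hm ⊢
    omega
  have hzero : ∀ m ∈ Finset.Icc 2 M, m ∉ Finset.Ioc N M → x m = 0 := by
    intro m hm hm'
    simp only [Finset.mem_Ioc, Finset.mem_Icc, not_and, not_le] at hm hm'
    exact hsupp m (Or.inl (by by_contra h; exact absurd (hm' (not_le.1 h)) (by omega)))
  have hsq : ∑ m ∈ Finset.Icc 2 M, x m ^ 2 = ∑ m ∈ Finset.Ioc N M, x m ^ 2 :=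
    (Finset.sum_subset hsub fun m hm hm' => by rw [hzero m hm hm']; ring).symm
  have hlin : ∑ m ∈ Finset.Ioc N M, x m = 0 := by
    rw [Finset.sum_subset hsub fun m hm hm' => hzero m hm hm']
    exact hx
  have hdbl : ∑ m ∈ Finset.Icc 2 M, ∑ m' ∈ Finset.Icc 2 M,
        zetaScrewKernel (Real.log m) (Real.log m') * (x m * x m')
      = ∑ m ∈ Finset.Ioc N M, ∑ m' ∈ Finset.Ioc N M,
        zetaScrewKernel (Real.log m) (Real.log m') * (x m * x m') := by
    symm
    refine (Finset.sum_subset hsub fun m hm hm' => ?_).trans ?_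
    · exact Finset.sum_eq_zero fun m' _ => by rw [hzero m hm hm']; ring
    · refine Finset.sum_congr rfl fun m _ => ?_
      exact Finset.sum_subset hsub fun m' hm' hm'' => by rw [hzero m' hm' hm'']; ring
  rw [hsq, hdbl, Real.rpow_neg_one]
  exact screwWindowFloor N M x hMN hlin

end Summit.RiemannHypothesis.RiemannHypothesis.Theorems.IntegerScrewLocalFloor

end
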